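import Literature.Algebra.EuclideanLattices.BabaiResidual
import Literature.Algebra.EuclideanLattices.LLLIntegral
import HarnessLib

/-!
# Babai's nearest-plane algorithm in integer arithmetic (Cohen's integral Gram–Schmidt data)

Topic `Algebra/EuclideanLattices` (family `pqc`), sequel of `BabaiResidual.lean` (`Babai.nearestPlane k f c`,
`Babai.residual`: the coefficients and the residual of Babai's nearest-plane algorithm over `ℝ`) and of
`LLLIntegral.lean` (Cohen's integral Gram–Schmidt data of integer vectors: `uRec`, `dRec`, with
`uRec b j i j = λᵢⱼ = d_{j+1} μᵢⱼ`, `dRec b l = dₗ`, all divisions exact, `uRec_cast_eq_gsU`). Everything here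
is PROVED; definitions with bodies (`Babai.roundDiv`, `Babai.intNearestPlane`, `Babai.intResidual`); no
named fact.

A machine that must hand the BDD solver the instance `x = residual(w)` (the first component of Peikert's
`GapSVP → LWE` reduction, `Cryptography/PeikertReduction.lean`, pqc.S20) computes Babai's coefficients on
INTEGERS only: for integer rows `b₀, …, b_{k}` and an integer target `w`, the last coefficient is
`z = ⌊μ⌉`, `μ = ⟪w, b̃_k⟫/‖b̃_k‖² = λ/d_{k+1}` with `λ = λ_{w,k} = d_k ⟪w, b̃_k⟫` the integer that Cohen's
recursion computes for the EXTENDED family `(b₀, …, b_k, w)` at level `k` (`uRec (snoc b w) k (k+1) k`) and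
`d_{k+1} = dRec b (k+1)`; so `z = ⌊(2λ + d)/(2d)⌋` (`roundDiv`), and one recurses on the prefix rows with the
integer target `w - z b_k`. This file defines that integer recursion and proves it IS `Babai.nearestPlane`:

* `Babai.rowsR b` — the integer rows read in `ℝᵐ`; `gramDet_rowsR_snoc`, `rowsR_snoc_comp_castSucc` —
  appending a vector does not change the leading Gram determinants / the prefix family;
* `Babai.uRec_snoc_cast_eq_gsU` — **Cohen's recursion is exact on the extended family up to level `n`**
  when the first `n` vectors are linearly independent (the appended target may be dependent): the proof
  of `uRec_cast_eq_gsU` verbatim, the denominators `dₗ`, `l ≤ n`, being those of the independent prefix;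
* `Babai.roundDiv a d = ⌊(2a + d)/(2d)⌋ = round(a/d)` (`d > 0`);
* **`Babai.intNearestPlane`**, **`Babai.intNearestPlane_eq`** — the integer algorithm and its agreement with
  `Babai.nearestPlane k (rowsR b) (w read in ℝᵐ)` for linearly independent rows;
* `Babai.intResidual b w = w - ∑ zᵢbᵢ` and `intVecToEuclidean_intResidual` — its real reading is
  `Babai.residual`, so the shift-invariance and shortness theorems of `BabaiResidual*.lean` apply to the
  machine's integer output.

## References

* L. Babai, *On Lovász' lattice reduction and the nearest lattice point problem*, Combinatorica 6 (1986)
  1–13, §3 (procedure NEAREST PLANE) [Babai1986].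
* H. Cohen, *A Course in Computational Algebraic Number Theory*, GTM 138, Springer 1993, §2.6.3 and
  Algorithm 2.6.7 (integral Gram–Schmidt: the `dᵢ`, `λᵢⱼ`, nearest integers from them) [Cohen1993].
-/

noncomputable section

namespace Literature.Algebra.EuclideanLattices

open InnerProductSpace Finset GPVSampler
open scoped RealInnerProductSpace

namespace Babai

variable {m : ℕ}

/-! ### Integer rows read in `ℝᵐ`; appending a vector -/

/-- The integer rows `b` read in `ℝᵐ` (the family `LLLIntegral.lean` computes with). [folklore] -/
abbrev rowsR {n : ℕ} (b : Fin n → (Fin m → ℤ)) : Fin n → EuclideanSpace ℝ (Fin m) :=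
  ⇑(intVecToEuclidean m).toAddMonoidHom ∘ b

/-- The prefix of the extended family `(b, w)` is `b`. [folklore] -/
theorem rowsR_snoc_comp_castSucc {n : ℕ} (b : Fin n → (Fin m → ℤ)) (w : Fin m → ℤ) :
    rowsR (Fin.snoc b w : Fin (n + 1) → (Fin m → ℤ)) ∘ Fin.castSucc = rowsR b := by
  funext i
  simp [rowsR, Fin.snoc_castSucc]

/-- The last vector of the extended family is the target. [folklore] -/
theorem rowsR_snoc_last {n : ℕ} (b : Fin n → (Fin m → ℤ)) (w : Fin m → ℤ) :
    rowsR (Fin.snoc b w : Fin (n + 1) → (Fin m → ℤ)) (Fin.last n) = intVecToEuclidean m w := by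
  simp [rowsR, Fin.snoc_last]

/-- **Appending a vector does not change the leading Gram determinants**: `dₗ(b, w) = dₗ(b)` for `l ≤ n`.
[cite: Cohen1993, §2.6.3] -/
theorem gramDet_rowsR_snoc {n : ℕ} (b : Fin n → (Fin m → ℤ)) (w : Fin m → ℤ) (l : ℕ) (hl : l ≤ n) :
    gramDet (rowsR (Fin.snoc b w : Fin (n + 1) → (Fin m → ℤ))) l (hl.trans n.le_succ) = gramDet (rowsR b) l hl := by
  unfold gramDet
  have h : rowsR (Fin.snoc b w : Fin (n + 1) → (Fin m → ℤ)) ∘ Fin.castLE (hl.trans n.le_succ) =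
      rowsR b ∘ Fin.castLE hl := by
    funext x
    have hx : Fin.castLE (hl.trans n.le_succ) x = Fin.castSucc (Fin.castLE hl x) := Fin.ext rfl
    simp only [Function.comp_apply, hx]
    exact congrFun (rowsR_snoc_comp_castSucc b w) (Fin.castLE hl x)
  rw [h]

/-- The Gram–Schmidt vectors of the extended family at the old indices are the old ones. [folklore] -/
theorem gramSchmidt_rowsR_snoc_castSucc {n : ℕ} (b : Fin n → (Fin m → ℤ)) (w : Fin m → ℤ) (i : Fin n) :
    gramSchmidt ℝ (rowsR (Fin.snoc b w : Fin (n + 1) → (Fin m → ℤ))) (Fin.castSucc i) = gramSchmidt ℝ (rowsR b) i := by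
  rw [← Literature.Analysis.InnerProduct.gramSchmidt_comp_castSucc ℝ _ i, rowsR_snoc_comp_castSucc]

/-! ### Cohen's recursion on the extended family is exact up to level `n` -/

/-- **Exactness of the integer recursion on the extended family.** If the rows `b₀, …, b_{n-1}` are
linearly independent (in `ℝᵐ`), then for the extended family `(b, w)` — whatever `w`, possibly dependent —
Cohen's integer recursion computes `uₗ(i, j) = dₗ ⟪vᵢ, πₗ(vⱼ)⟫` exactly for every level `l ≤ n` and all
indices `i, j ≤ n` (the denominators met are `d₀, …, d_{n-1} ≥ 1`, Gram determinants of the independent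
prefix). The proof is that of `uRec_cast_eq_gsU`. [cite: Cohen1993, Algorithm 2.6.7] -/
theorem uRec_snoc_cast_eq_gsU {n : ℕ} (b : Fin n → (Fin m → ℤ)) (w : Fin m → ℤ)
    (hli : LinearIndependent ℝ (rowsR b)) :
    ∀ (l : ℕ) (hl : l ≤ n) (i j : Fin (n + 1)),
      (uRec (Fin.snoc b w : Fin (n + 1) → (Fin m → ℤ)) l i j : ℝ) =
        gsU (rowsR (Fin.snoc b w : Fin (n + 1) → (Fin m → ℤ))) l (hl.trans n.le_succ) i j := by
  set B : Fin (n + 1) → (Fin m → ℤ) := Fin.snoc b w with hB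
  set f := rowsR B with hf
  intro l
  induction l using Nat.strong_induction_on with
  | _ l ih =>
    intro hl i j
    obtain _ | l := l
    · rw [uRec_zero, cast_intGram, gsU_zero]
      rfl
    have hln : l < n := hl
    have hln' : l < n + 1 := by omega
    set L : Fin (n + 1) := ⟨l, hln'⟩ with hL
    have ih' := ih l (Nat.lt_succ_self l) hln.le
    -- the denominator is `d_l ≥ 1` (a Gram determinant of the independent prefix)
    have hden : (dRec B l : ℝ) = gramDet f l (by omega) := by
      obtain _ | l' := l
      · simp [dRec, gramDet_zero]
      · have h' : l' < n + 1 := by omega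
        simp only [dRec, dif_pos h']
        rw [ih l' (by omega) (by omega) ⟨l', h'⟩ ⟨l', h'⟩]
        exact gsU_self f ⟨l', h'⟩
    obtain ⟨D, hD⟩ := exists_gramDet_eq_intCast B l (by omega)
    have hD1 : 1 ≤ D := by
      have h1 := one_le_gramDet b hli l hln.le
      rw [← gramDet_rowsR_snoc b w l hln.le] at h1
      have : (1 : ℝ) ≤ D := by rw [← hD]; exact h1
      exact_mod_cast this
    obtain ⟨z, hz⟩ := exists_gsU_eq_intCast B (l + 1) (by omega) i j
    -- the numerator is `d_l · u_{l+1}`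
    have hnum : ((uRec B l L L * uRec B l i j - uRec B l j L * uRec B l i L : ℤ) : ℝ) = D * z := by
      push_cast
      rw [ih' L L, ih' i j, ih' j L, ih' i L, gsU_self f L, gsU_self_right f j L, gsU_self_right f i L, ← hz, ← hD]
      have := gramDet_mul_gsU_succ f L i j
      rw [show gramDet f (↑L) (le_of_lt L.isLt) = gramDet f l (by omega) from rfl] at this
      linarith [this]
    have hdenZ : dRec B l = D := by exact_mod_cast hden.trans hD
    have hnumZ : uRec B l L L * uRec B l i j - uRec B l j L * uRec B l i L = D * z := by exact_mod_cast hnum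
    have e1 : uRec B (l + 1) i j = (uRec B l L L * uRec B l i j - uRec B l j L * uRec B l i L) / dRec B l :=
      uRec_succ B L i j
    rw [e1, hnumZ, hdenZ, Int.mul_ediv_cancel_left _ (by omega), ← hz]

/-! ### Nearest integer of a fraction in integers -/

/-- **`⌊a/d⌉` in integer arithmetic**: `roundDiv a d = ⌊(2a + d)/(2d)⌋` (ties upward, as Mathlib's
`round`). [cite: Cohen1993, Algorithm 2.6.7 (sub-algorithm RED: `q = ⌊½ + λ/d⌋`)] -/
def roundDiv (a d : ℤ) : ℤ := (2 * a + d) / (2 * d)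

/-- `roundDiv a d = round (a/d)` for `d > 0`. [folklore] -/
theorem roundDiv_eq_round (a : ℤ) {d : ℤ} (hd : 0 < d) : roundDiv a d = round ((a : ℝ) / (d : ℝ)) := by
  rw [round_eq, roundDiv, ← floor_intCast_div_intCast (2 * a + d) (by omega : (0 : ℤ) < 2 * d)]
  congr 1
  push_cast
  have hd' : (d : ℝ) ≠ 0 := by exact_mod_cast hd.ne'
  field_simp

/-! ### The integer nearest-plane algorithm -/

/-- **Babai's nearest-plane algorithm on integers** (the deterministic procedure of `Babai.nearestPlane`,
with the last centre `μ = ⟪w, b̃_k⟫/‖b̃_k‖²` read off Cohen's data as `λ/d_{k+1}`,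
`λ = uRec (b, w) k (k+1) k`, `d_{k+1} = dRec b (k+1)`): last coefficient `z = roundDiv λ d_{k+1}`, then
recurse on the prefix rows with the integer target `w - z b_k`. [cite: Babai1986, §3; Cohen1993, Algorithm 2.6.7] -/
def intNearestPlane : (k : ℕ) → (Fin k → (Fin m → ℤ)) → (Fin m → ℤ) → (Fin k → ℤ)
  | 0, _, _ => fun i => i.elim0
  | k + 1, b, w =>
      let z : ℤ := roundDiv (uRec (Fin.snoc b w : Fin (k + 2) → (Fin m → ℤ)) k (Fin.last (k + 1))
        (Fin.castSucc (Fin.last k))) (dRec b (k + 1))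
      Fin.snoc (intNearestPlane k (b ∘ Fin.castSucc) (w - z • b (Fin.last k))) z

/-- Unfolding of one step. [folklore] -/
theorem intNearestPlane_succ {k : ℕ} (b : Fin (k + 1) → (Fin m → ℤ)) (w : Fin m → ℤ) :
    intNearestPlane (k + 1) b w =
      Fin.snoc (intNearestPlane k (b ∘ Fin.castSucc)
        (w - roundDiv (uRec (Fin.snoc b w : Fin (k + 2) → (Fin m → ℤ)) k (Fin.last (k + 1))
          (Fin.castSucc (Fin.last k))) (dRec b (k + 1)) • b (Fin.last k)))
        (roundDiv (uRec (Fin.snoc b w : Fin (k + 2) → (Fin m → ℤ)) k (Fin.last (k + 1))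
          (Fin.castSucc (Fin.last k))) (dRec b (k + 1))) := rfl

/-- **The last centre from Cohen's data**: for linearly independent rows `b₀, …, b_k` and any integer
target `w`, `λ/d_{k+1} = ⟪w, b̃_k⟫/‖b̃_k‖²` with `λ = uRec (b, w) k (k+1) k` and `d_{k+1} = dRec b (k+1) > 0`.
[cite: Cohen1993, Algorithm 2.6.7] -/
theorem lastCenter_eq_div {k : ℕ} (b : Fin (k + 1) → (Fin m → ℤ)) (w : Fin m → ℤ)
    (hli : LinearIndependent ℝ (rowsR b)) :
    0 < dRec b (k + 1) ∧
      lastCenter (rowsR b) (intVecToEuclidean m w) =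
        (uRec (Fin.snoc b w : Fin (k + 2) → (Fin m → ℤ)) k (Fin.last (k + 1)) (Fin.castSucc (Fin.last k)) : ℝ) /
          (dRec b (k + 1) : ℝ) := by
  set f := rowsR b with hf
  set B : Fin (k + 2) → (Fin m → ℤ) := Fin.snoc b w with hB
  have hd : (dRec b (k + 1) : ℝ) = gramDet f (k + 1) le_rfl := dRec_cast_eq_gramDet b hli (k + 1) le_rfl
  have hd1 : (1 : ℝ) ≤ dRec b (k + 1) := by rw [hd]; exact one_le_gramDet b hli (k + 1) le_rfl
  refine ⟨by exact_mod_cast (lt_of_lt_of_le one_pos hd1), ?_⟩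
  -- `λ = d_k ⟪w, b̃_k⟫`
  have hlam : (uRec B k (Fin.last (k + 1)) (Fin.castSucc (Fin.last k)) : ℝ) =
      gramDet f k (Nat.le_succ k) * ⟪intVecToEuclidean m w, gramSchmidt ℝ f (Fin.last k)⟫ := by
    have h1 := uRec_snoc_cast_eq_gsU b w hli k (Nat.le_succ k) (Fin.last (k + 1)) (Fin.castSucc (Fin.last k))
    have h2 := gsU_self_right (rowsR B) (Fin.last (k + 1)) (Fin.castSucc (Fin.last k))
    simp only [Fin.val_castSucc, Fin.val_last] at h2
    have h3 : gramDet (rowsR B) ((Fin.castSucc (Fin.last k) : Fin (k + 2)) : ℕ)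
        (le_of_lt (Fin.castSucc (Fin.last k)).isLt) = gramDet f k (Nat.le_succ k) :=
      gramDet_rowsR_snoc b w k (Nat.le_succ k)
    rw [h1, h2, gsNum, h3, gramSchmidt_rowsR_snoc_castSucc, rowsR_snoc_last]
  -- `d_{k+1} = d_k ‖b̃_k‖²`
  have hdk : (dRec b (k + 1) : ℝ) = gramDet f k (Nat.le_succ k) * ‖gramSchmidt ℝ f (Fin.last k)‖ ^ 2 := by
    rw [hd]; exact gramDet_succ f (Fin.last k)
  have hk0 : 0 < gramDet f k (Nat.le_succ k) := lt_of_lt_of_le one_pos (one_le_gramDet b hli k (Nat.le_succ k))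
  have hgs : gramSchmidt ℝ f (Fin.last k) ≠ 0 := gramSchmidt_ne_zero _ hli
  have hn0 : 0 < ‖gramSchmidt ℝ f (Fin.last k)‖ ^ 2 := pow_pos (norm_pos_iff.2 hgs) 2
  rw [hlam, hdk, lastCenter]
  field_simp

/-- **The integer algorithm is Babai's nearest-plane algorithm**: for linearly independent integer rows,
`intNearestPlane k b w = nearestPlane k (rowsR b) w` (the target read in `ℝᵐ`).
[cite: Babai1986, §3; Cohen1993, Algorithm 2.6.7] -/
theorem intNearestPlane_eq : ∀ (k : ℕ) (b : Fin k → (Fin m → ℤ)) (_ : LinearIndependent ℝ (rowsR b))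
    (w : Fin m → ℤ), intNearestPlane k b w = nearestPlane k (rowsR b) (intVecToEuclidean m w)
  | 0, _, _, _ => funext fun i => i.elim0
  | k + 1, b, hli, w => by
      obtain ⟨hdpos, hcen⟩ := lastCenter_eq_div b w hli
      set z : ℤ := roundDiv (uRec (Fin.snoc b w : Fin (k + 2) → (Fin m → ℤ)) k (Fin.last (k + 1))
        (Fin.castSucc (Fin.last k))) (dRec b (k + 1)) with hz
      have hround : z = round (lastCenter (rowsR b) (intVecToEuclidean m w)) := by
        rw [hz, roundDiv_eq_round _ hdpos, hcen]
      -- the prefix rows are independent and are `rowsR (b ∘ castSucc)`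
      have hpre : rowsR (b ∘ Fin.castSucc) = rowsR b ∘ Fin.castSucc := rfl
      have hli' : LinearIndependent ℝ (rowsR (b ∘ Fin.castSucc)) := by
        rw [hpre]; exact hli.comp _ (Fin.castSucc_injective k)
      -- the new integer target read in `ℝᵐ`
      have htgt : intVecToEuclidean m (w - z • b (Fin.last k)) =
          intVecToEuclidean m w - (z : ℝ) • rowsR b (Fin.last k) := by
        rw [map_sub, map_zsmul, Int.cast_smul_eq_zsmul]
        rfl
      rw [intNearestPlane_succ, ← hz, intNearestPlane_eq k (b ∘ Fin.castSucc) hli' (w - z • b (Fin.last k)),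
        nearestPlane_succ, htgt, hpre, ← hround]

/-! ### The integer residual -/

/-- **The integer residual** `w - ∑ zᵢ bᵢ` of the integer nearest-plane algorithm (the BDD instance
`x = w mod B` handed to the solver by the machine). [cite: Babai1986, §3] -/
def intResidual {n : ℕ} (b : Fin n → (Fin m → ℤ)) (w : Fin m → ℤ) : Fin m → ℤ :=
  w - ∑ i, intNearestPlane n b w i • b i

/-- **The integer residual read in `ℝᵐ` is Babai's residual** (linearly independent rows), so that the
shift invariance (`residual_add_of_mem_span`), membership (`sub_residual_mem_span`) and shortness
(`norm_residual_le`) theorems apply to it. [cite: Babai1986, §3] -/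
theorem intVecToEuclidean_intResidual {n : ℕ} (b : Fin n → (Fin m → ℤ)) (hli : LinearIndependent ℝ (rowsR b))
    (w : Fin m → ℤ) :
    intVecToEuclidean m (intResidual b w) = residual n (rowsR b) (intVecToEuclidean m w) := by
  rw [intResidual, residual, map_sub, map_sum, intNearestPlane_eq n b hli w, vecOf]
  congr 1
  refine Finset.sum_congr rfl fun i _ => ?_
  rw [map_zsmul, Int.cast_smul_eq_zsmul]
  rfl

end Babai

end Literature.Algebra.EuclideanLattices

end
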